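import Summits.KontsevichZagierPeriods.KontsevichZagierPeriods.Theses.ComplexOrientations
import Summits.KontsevichZagierPeriods.KontsevichZagierPeriods.Theorems.ComplexOrientationsOrientationKernelStubSectorMerge

/-!
# Crux `OrientationKernel` (stmt-KontsevichZagierPeriods-11367), line `birth`: the logical position of
`stub_sectorReduction` — it is NECESSARY for the crux

The registered line `birth` cuts the crux `ComplexOrientations.OrientationKernel` (the kernel conjecture of
the Kontsevich–Zagier calculus of moves enlarged by the route's three relator families) along the
**1-period sector**

  `S := AddSubgroup.closure ({[s] | s : IntegralRep 0} ∪ {[s] | s : IntegralRep 1} ∪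
        {[s] | s : IntegralRep 2, s.domain bounded, s.integrand = 1 on it})`

into `stub_sectorReduction` (every vanishing formal combination is congruent modulo `KZ.relations` to an
element of `S`), `stub_sectorMerge` (landed) and `stub_planarAreas` (= item stmt-4990).

This file proves the converse bookkeeping: **`OrientationKernel → stub_sectorReduction`**. Take the
admissible subgroup `R₀ := KZ.relations ⊔ S`. Every relator the crux adjoins lies in `S`:

* the oval combinations `∑ ηᵢ • [sᵢ] − [e]` of families (i) and (ii): each `sᵢ` is a planar
  integrand-`1` representation over the "interior" `{v ∉ Oᵢ ∧ the component of Oᵢᶜ at v is bounded}` of an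
  oval `Oᵢ` of a real plane curve with COMPACT real locus, and that interior is bounded
  (`isBounded_setOf_isBounded_connectedComponentIn_compl`: a point far out lies in an open coordinate
  half-plane, which is convex, unbounded and misses the curve, so its component in `Oᵢᶜ` is unbounded);
  the `π`-carrier `e` is a disc, bounded;
* the Cauchy relators of family (iii) are classes of representations of dimension `1`.

Hence `OrientationKernel` at `R₀` gives `ker eval ⊆ KZ.relations ⊔ S`, which is `stub_sectorReduction`
(`AddSubgroup.mem_sup`). Together with the skeleton's composition (`stub_sectorReduction ∧ stub_sectorMerge ∧
stub_planarAreas → OrientationKernel`) this records that the cut is an equivalence cut modulo the merge and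
the planar kernel: the stub `stub_sectorReduction` is exactly as strong as the crux relative to the
1-period layer — crux-sized by theorem.

No definitions are introduced; only Mathlib topology / algebra and the route file are used.

References: M. Kontsevich, D. Zagier, *Periods* (2001), §1.2 (the calculus and Conjecture 1);
A. Huber, G. Wüstholz, *Transcendence and linear relations of 1-periods* (2022) (the 1-period layer).
-/

noncomputable section

open Literature.NumberTheory.Transcendental

namespace Summit.KontsevichZagierPeriods.ComplexOrientations.OrientationKernel

/-- **Far points have unbounded complementary components.** In `ℝ²` with the sup norm: if
`O ⊆ closedBall 0 M` and the connected component of `Oᶜ` containing `v` is bounded, then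
`‖v‖ ≤ M` (for `v ∈ O` the component is empty and the conclusion is `O ⊆ closedBall 0 M`; the
content is the case `v ∉ O`). Indeed, if `‖v‖ > M` then some coordinate satisfies `M < |v i|`, and
the open half-plane `{w | M < ± w i}` through `v` is convex (hence preconnected), misses the ball
(hence `O`), and is unbounded, so it lies in the component of `Oᶜ` at `v`, which is then unbounded.
[folklore] -/
theorem norm_le_of_isBounded_connectedComponentIn_compl {O : Set (Fin 2 → ℝ)} {M : ℝ}
    (hO : O ⊆ Metric.closedBall 0 M) {v : Fin 2 → ℝ}
    (hv : Bornology.IsBounded (connectedComponentIn Oᶜ v)) : ‖v‖ ≤ M := by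
  by_contra hM
  rw [not_le] at hM
  -- some coordinate of `v` exceeds `M` in absolute value
  obtain ⟨i, hi⟩ : ∃ i, M < |v i| := by
    by_contra h
    simp only [not_exists, not_lt] at h
    exact absurd ((pi_norm_le_iff_of_nonempty v).2 fun b => (Real.norm_eq_abs (v b)).le.trans (h b))
      (not_le.2 hM)
  -- a sign `ε = ±1` with `M < ε * v i`
  obtain ⟨ε, hε, hεv⟩ : ∃ ε : ℝ, (ε = 1 ∨ ε = -1) ∧ M < ε * v i := by
    rcases le_or_gt 0 (v i) with h | h
    · exact ⟨1, Or.inl rfl, by rwa [one_mul, ← abs_of_nonneg h]⟩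
    · refine ⟨-1, Or.inr rfl, ?_⟩
      rw [abs_of_neg h] at hi
      linarith
  have hε2 : ε * ε = 1 := by rcases hε with rfl | rfl <;> norm_num
  have hεabs : ∀ t : ℝ, ε * t ≤ |t| := by
    intro t
    rcases hε with rfl | rfl
    · simpa using le_abs_self t
    · simpa using neg_le_abs t
  -- the open half-plane through `v` beyond the ball
  set H : Set (Fin 2 → ℝ) := {w | M < ε * w i} with hH
  have hconv : Convex ℝ H := by
    refine convex_halfSpace_gt (f := fun w : Fin 2 → ℝ => ε * w i) ⟨fun x y => ?_, fun c x => ?_⟩ M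
    · simp only [Pi.add_apply, mul_add]
    · simp only [Pi.smul_apply, smul_eq_mul]
      ring
  have hvH : v ∈ H := hεv
  have hHO : H ⊆ Oᶜ := by
    intro w hw hwO
    have h1 : ‖w‖ ≤ M := mem_closedBall_zero_iff.1 (hO hwO)
    have h2 : |w i| ≤ M := ((Real.norm_eq_abs (w i)).symm.le.trans (norm_le_pi_norm w i)).trans h1
    exact absurd ((hεabs (w i)).trans h2) (not_le.2 hw)
  have hsub : H ⊆ connectedComponentIn Oᶜ v :=
    hconv.isPreconnected.subset_connectedComponentIn hvH hHO
  -- but `H` is unbounded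
  obtain ⟨R, hR⟩ := (Metric.isBounded_iff_subset_closedBall (0 : Fin 2 → ℝ)).1 (hv.subset hsub)
  set t : ℝ := max M R + 1 with ht
  have htM : M < t := by
    have := le_max_left M R
    linarith
  have htR : R < t := by
    have := le_max_right M R
    linarith
  have hw : (fun _ : Fin 2 => ε * t) ∈ H := by
    show M < ε * (ε * t)
    rwa [← mul_assoc, hε2, one_mul]
  have h3 : ‖(fun _ : Fin 2 => ε * t)‖ ≤ R := mem_closedBall_zero_iff.1 (hR hw)
  have h4 : |ε * t| ≤ R :=
    ((Real.norm_eq_abs _).symm.le.trans (norm_le_pi_norm (fun _ : Fin 2 => ε * t) i)).trans h3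
  have h5 : |ε * t| = |t| := by rcases hε with rfl | rfl <;> simp
  rw [h5] at h4
  exact absurd ((le_abs_self t).trans h4) (not_le.2 htR)

/-- **Oval interiors of a compact curve are bounded.** If `O` lies in a compact subset `K` of `ℝ²`,
the set `{v | v ∉ O ∧ the connected component of Oᶜ at v is bounded}` (the union of the bounded
complementary components of `O` — for an oval `O` of a real plane curve with compact real locus `K`,
its interior in the sense of the route `ComplexOrientations`) is bounded: it lies in every sup-norm
ball about `0` containing `K`. [folklore] -/
theorem isBounded_setOf_isBounded_connectedComponentIn_compl {K O : Set (Fin 2 → ℝ)}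
    (hK : IsCompact K) (hO : O ⊆ K) :
    Bornology.IsBounded {v : Fin 2 → ℝ | v ∉ O ∧ Bornology.IsBounded (connectedComponentIn Oᶜ v)} := by
  obtain ⟨M, hM⟩ := (Metric.isBounded_iff_subset_closedBall (0 : Fin 2 → ℝ)).1 hK.isBounded
  exact Metric.isBounded_closedBall.subset fun v hv =>
    mem_closedBall_zero_iff.2 (norm_le_of_isBounded_connectedComponentIn_compl (hO.trans hM) hv.2)

/-- **The `π`-carrier is bounded.** The open disc `{v | v 0 ^ 2 + v 1 ^ 2 < β}` of `ℝ²` is bounded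
(it lies in the sup-norm ball of radius `|β| + 1`). [folklore] -/
theorem isBounded_disc (β : ℝ) :
    Bornology.IsBounded {v : Fin 2 → ℝ | v 0 ^ 2 + v 1 ^ 2 < β} := by
  refine (Metric.isBounded_closedBall (x := (0 : Fin 2 → ℝ)) (r := |β| + 1)).subset ?_
  intro v hv
  have hv' : v 0 ^ 2 + v 1 ^ 2 < β := hv
  rw [mem_closedBall_zero_iff, pi_norm_le_iff_of_nonneg (by positivity)]
  intro i
  rw [Real.norm_eq_abs]
  have hβ : β ≤ |β| := le_abs_self β
  have hi : v i ^ 2 < (|β| + 1) ^ 2 := by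
    have hvi : v i ^ 2 ≤ v 0 ^ 2 + v 1 ^ 2 := by
      fin_cases i
      · simpa using sq_nonneg (v 1)
      · simpa using sq_nonneg (v 0)
    nlinarith [abs_nonneg β]
  exact (abs_lt_of_sq_lt_sq hi (by positivity)).le

/-- **The oval combinations lie in the 1-period sector.** For a real plane curve `{p = 0}` with
compact real locus, ovals `Oᵢ` (connected components of the real locus), planar representations `sᵢ`
with integrand `1` over the interiors `{v ∉ Oᵢ ∧ the component of Oᵢᶜ at v is bounded}`, and a
`π`-carrier `e` (integrand `1` over a disc), every integer combination `∑ nᵢ • [sᵢ] − [e]` lies in the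
subgroup `S` generated by the 1-period-sector generators (indeed in the part generated by bounded
planar integrand-`1` representations), hence in `KZ.relations ⊔ S`. This covers both relator
families (i) (unit signs, type I) and (ii) (all integer identities) of the crux, whose extra
hypotheses (smoothness, irreducibility, dividing type, algebraicity of `β`, the value identity) are
not needed for membership. [folklore] -/
theorem ovalCombination_mem_sup_sector (S : AddSubgroup KZ.FormalRep)
    (hS : ∀ s : KZ.IntegralRep 2, Bornology.IsBounded s.domain → (∀ v ∈ s.domain, s.integrand v = 1) →
      KZ.of s ∈ S)
    (p : MvPolynomial (Fin 2) ℚ) (hp : IsCompact {v : Fin 2 → ℝ | MvPolynomial.aeval v p = 0})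
    (k : ℕ) (O : Fin k → Set (Fin 2 → ℝ)) (s : Fin k → KZ.IntegralRep 2)
    (hO : ∀ i, ∃ v : Fin 2 → ℝ, MvPolynomial.aeval v p = 0 ∧
      O i = connectedComponentIn {u : Fin 2 → ℝ | MvPolynomial.aeval u p = 0} v)
    (hdom : ∀ i, (s i).domain =
      {v : Fin 2 → ℝ | v ∉ O i ∧ Bornology.IsBounded (connectedComponentIn (O i)ᶜ v)})
    (hint : ∀ i, ∀ v ∈ (s i).domain, (s i).integrand v = 1)
    (n : Fin k → ℤ) (β : ℝ) (e : KZ.IntegralRep 2)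
    (he : e.domain = {v : Fin 2 → ℝ | v 0 ^ 2 + v 1 ^ 2 < β}) (heint : ∀ v ∈ e.domain, e.integrand v = 1) :
    (∑ i, n i • KZ.of (s i)) - KZ.of e ∈ KZ.relations ⊔ S := by
  refine AddSubgroup.mem_sup_right (S.sub_mem (S.sum_mem fun i _ => S.zsmul_mem (hS _ ?_ (hint i)) _)
    (hS _ ?_ heint))
  · obtain ⟨v, -, hOi⟩ := hO i
    rw [hdom i]
    exact isBounded_setOf_isBounded_connectedComponentIn_compl hp (hOi ▸ connectedComponentIn_subset _ _)
  · rw [he]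
    exact isBounded_disc β

/-- **`OrientationKernel → stub_sectorReduction` (the stub is necessary for the crux).** If every
subgroup `R ≥ KZ.relations` containing the route's three relator families contains `ker KZ.eval`
(the crux `ComplexOrientations.OrientationKernel`), then every formal combination with value `0` is
congruent modulo `KZ.relations` to an element of the 1-period sector
`S = closure ({[s] | s : IntegralRep 0} ∪ {[s] | s : IntegralRep 1} ∪ {[s] | s planar, bounded, integrand 1})`
— the registered stub `stub_sectorReduction` of line `birth`, verbatim. Proof: `R₀ := KZ.relations ⊔ S`
is admissible (`ovalCombination_mem_sup_sector` for families (i), (ii); family (iii) consists of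
classes of 1-dimensional representations), and `x ∈ KZ.relations ⊔ S` unfolds to the conclusion by
`AddSubgroup.mem_sup`. [folklore; Kontsevich–Zagier 2001, §1.2] -/
theorem sectorReduction_of_orientationKernel :
    Summit.KontsevichZagierPeriods.KontsevichZagierPeriods.Theses.ComplexOrientations.OrientationKernel →
    ∀ x : KZ.FormalRep, KZ.eval x = 0 →
      ∃ y ∈ AddSubgroup.closure
          ({c : KZ.FormalRep | ∃ s : KZ.IntegralRep 0, c = KZ.of s} ∪
            {c : KZ.FormalRep | ∃ s : KZ.IntegralRep 1, c = KZ.of s} ∪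
            {c : KZ.FormalRep | ∃ s : KZ.IntegralRep 2, Bornology.IsBounded s.domain ∧
              (∀ v ∈ s.domain, s.integrand v = 1) ∧ c = KZ.of s}),
        x - y ∈ KZ.relations := by
  intro hK x hx
  set S : AddSubgroup KZ.FormalRep := AddSubgroup.closure
    ({c : KZ.FormalRep | ∃ s : KZ.IntegralRep 0, c = KZ.of s} ∪
      {c : KZ.FormalRep | ∃ s : KZ.IntegralRep 1, c = KZ.of s} ∪
      {c : KZ.FormalRep | ∃ s : KZ.IntegralRep 2, Bornology.IsBounded s.domain ∧
        (∀ v ∈ s.domain, s.integrand v = 1) ∧ c = KZ.of s}) with hS_def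
  have planar_mem : ∀ s : KZ.IntegralRep 2, Bornology.IsBounded s.domain →
      (∀ v ∈ s.domain, s.integrand v = 1) → KZ.of s ∈ S :=
    fun s hb h1 => AddSubgroup.subset_closure (Or.inr ⟨s, hb, h1, rfl⟩)
  have one_mem : ∀ s : KZ.IntegralRep 1, KZ.of s ∈ S :=
    fun s => AddSubgroup.subset_closure (Or.inl (Or.inr ⟨s, rfl⟩))
  have hxR : x ∈ KZ.relations ⊔ S := by
    refine hK (KZ.relations ⊔ S) le_sup_left ?_ ?_ ?_ x hx
    · intro p hp _ _ _ k O s hO _ _ hdom hint η β e _ _ _ he heint _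
      exact ovalCombination_mem_sup_sector S planar_mem p hp k O s hO hdom hint η β e he heint
    · intro p hp _ k O s hO _ _ hdom hint n β e _ _ he heint _
      exact ovalCombination_mem_sup_sector S planar_mem p hp k O s hO hdom hint n β e he heint
    · intro _ _ _ _ _ _ _ _ r _ _
      exact AddSubgroup.mem_sup_right (one_mem r)
  obtain ⟨a, ha, b, hb, hab⟩ := AddSubgroup.mem_sup.1 hxR
  exact ⟨b, hb, by rwa [← hab, add_sub_cancel_right]⟩

/-! ## Part 2 (appended by lead c9, same session): the EXACT logical position of the line —
`OrientationKernel ↔ SectorReduction ∧ SectorKernel`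

Notation (all inlined below, no definitions are introduced):

* the **1-period sector** `S := AddSubgroup.closure ({[s] | s : IntegralRep 0} ∪ {[s] | s : IntegralRep 1} ∪
  {[s] | s : IntegralRep 2, s.domain bounded, s.integrand = 1 on it})` of `KZ.FormalRep`;
* `SectorReduction` = the registered stub `stub_sectorReduction` of line `birth`: every `x` with
  `KZ.eval x = 0` is congruent modulo `KZ.relations` to some `y ∈ S`;
* `SectorKernel` = the crux RESTRICTED to the sector: every subgroup `R ≥ KZ.relations` containing the
  route's three relator families (type-I oval identities, oval-sector identities, Cauchy relators)
  contains every `y ∈ S` with `KZ.eval y = 0`.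

Results:

* `orientationKernel_iff_sectorReduction_and_sectorKernel` : the crux is EQUIVALENT to the conjunction
  (`→`: `sectorReduction_of_orientationKernel`, landed, and restriction; `←`: reduce `x ≡ y ∈ S`, read
  `eval y = 0` off soundness `KZ.relations_le_ker_eval_holds`, put `y ∈ R`, climb back);
* `sector_mem_relations_of_boundedPlanarKernel` : the bounded planar kernel (two BOUNDED planar
  integrand-`1` representations of equal area are congruent modulo the moves) puts every vanishing
  element of `S` in `KZ.relations` — by the landed merge `stub_sectorMerge` and soundness — hence gives
  `SectorKernel` for every admissible `R` (`sectorKernel_of_boundedPlanarKernel`);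
* `boundedPlanarKernel_of_planarAreas` : the registered stub `stub_planarAreas` (= item
  stmt-KontsevichZagierPeriods-4990 verbatim) gives the bounded planar kernel.

So the registered skeleton `stub_sectorReduction ∧ stub_sectorMerge ∧ stub_planarAreas → OrientationKernel`
is an equivalence cut up to replacing `SectorKernel` by the (stronger) planar kernel 4990, and BOTH open stubs
are conjecture-grade: `stub_sectorReduction` is crux-hard relative to the 1-period layer (the crux implies
it), `stub_planarAreas` is the shared crux 4990.

References: M. Kontsevich, D. Zagier, *Periods* (2001), §1.2; A. Huber, G. Wüstholz, *Transcendence and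
linear relations of 1-periods* (2022).
-/
/-- **The exact logical position of line `birth`**: the crux `OrientationKernel` is equivalent to
the conjunction of the registered stub `stub_sectorReduction` (every vanishing combination is
congruent modulo the moves to an element of the 1-period sector `S`) and of the crux restricted to
`S` (every admissible `R` contains the vanishing elements of `S`). `→`: the landed necessity
`sectorReduction_of_orientationKernel` and restriction. `←`: given `x` with `eval x = 0`, reduce
`x ≡ y` with `y ∈ S`; soundness of the moves (`KZ.relations_le_ker_eval_holds`) gives `eval y = 0`,
the restricted kernel gives `y ∈ R`, and `x = (x − y) + y ∈ R` since `KZ.relations ≤ R`.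
[folklore; Kontsevich–Zagier 2001, §1.2] -/
theorem orientationKernel_iff_sectorReduction_and_sectorKernel :
    Summit.KontsevichZagierPeriods.KontsevichZagierPeriods.Theses.ComplexOrientations.OrientationKernel ↔
    (∀ x : KZ.FormalRep, KZ.eval x = 0 → ∃ y ∈ AddSubgroup.closure ({c : KZ.FormalRep | ∃ s :
      KZ.IntegralRep 0, c = KZ.of s} ∪ {c : KZ.FormalRep | ∃ s : KZ.IntegralRep 1, c = KZ.of s} ∪ {c
      : KZ.FormalRep | ∃ s : KZ.IntegralRep 2, Bornology.IsBounded s.domain ∧ (∀ v ∈ s.domain,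
      s.integrand v = 1) ∧ c = KZ.of s}), x - y ∈ KZ.relations) ∧
    (∀ R : AddSubgroup KZ.FormalRep, KZ.relations ≤ R → (∀ (p : MvPolynomial (Fin 2) ℚ), IsCompact
      {v : Fin 2 → ℝ | MvPolynomial.aeval v p = 0} → (∀ w : Fin 2 → ℂ, MvPolynomial.aeval w p = 0 →
      ∃ i, MvPolynomial.aeval w (MvPolynomial.pderiv i p) ≠ 0) → Irreducible (MvPolynomial.map
      (algebraMap ℚ ℂ) p) → ¬ IsPreconnected {w : Fin 2 → ℂ | MvPolynomial.aeval w p = 0 ∧ ∃ i, (w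
      i).im ≠ 0} → ∀ (k : ℕ) (O : Fin k → Set (Fin 2 → ℝ)) (s : Fin k → KZ.IntegralRep 2), (∀ i, ∃ v
      : Fin 2 → ℝ, MvPolynomial.aeval v p = 0 ∧ O i = connectedComponentIn {u : Fin 2 → ℝ |
      MvPolynomial.aeval u p = 0} v) → Function.Injective O → (∀ v : Fin 2 → ℝ, MvPolynomial.aeval v
      p = 0 → ∃ i, v ∈ O i) → (∀ i, (s i).domain = {v : Fin 2 → ℝ | v ∉ O i ∧ Bornology.IsBounded
      (connectedComponentIn (O i)ᶜ v)}) → (∀ i, ∀ v ∈ (s i).domain, (s i).integrand v = 1) → ∀ (η :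
      Fin k → ℤ) (β : ℝ) (e : KZ.IntegralRep 2), (∀ i, η i = 1 ∨ η i = -1) → IsAlgebraic ℚ β → 0 ≤ β
      → e.domain = {v : Fin 2 → ℝ | v 0 ^ 2 + v 1 ^ 2 < β} → (∀ v ∈ e.domain, e.integrand v = 1) → ∑
      i, (η i : ℝ) * (s i).value = e.value → (∑ i, η i • KZ.of (s i)) - KZ.of e ∈ R) → (∀ (p :
      MvPolynomial (Fin 2) ℚ), IsCompact {v : Fin 2 → ℝ | MvPolynomial.aeval v p = 0} → (∀ v : Fin 2
      → ℝ, MvPolynomial.aeval v p = 0 → ∃ i, MvPolynomial.aeval v (MvPolynomial.pderiv i p) ≠ 0) → ∀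
      (k : ℕ) (O : Fin k → Set (Fin 2 → ℝ)) (s : Fin k → KZ.IntegralRep 2), (∀ i, ∃ v : Fin 2 → ℝ,
      MvPolynomial.aeval v p = 0 ∧ O i = connectedComponentIn {u : Fin 2 → ℝ | MvPolynomial.aeval u
      p = 0} v) → Function.Injective O → (∀ v : Fin 2 → ℝ, MvPolynomial.aeval v p = 0 → ∃ i, v ∈ O
      i) → (∀ i, (s i).domain = {v : Fin 2 → ℝ | v ∉ O i ∧ Bornology.IsBounded (connectedComponentIn
      (O i)ᶜ v)}) → (∀ i, ∀ v ∈ (s i).domain, (s i).integrand v = 1) → ∀ (n : Fin k → ℤ) (β : ℝ) (e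
      : KZ.IntegralRep 2), IsAlgebraic ℚ β → 0 ≤ β → e.domain = {v : Fin 2 → ℝ | v 0 ^ 2 + v 1 ^ 2 <
      β} → (∀ v ∈ e.domain, e.integrand v = 1) → ∑ i, (n i : ℝ) * (s i).value = e.value → (∑ i, n i
      • KZ.of (s i)) - KZ.of e ∈ R) → (∀ (ρ R' : ℝ) (g : ℂ → ℂ), 0 < ρ → ρ < R' → IsAlgebraic ℚ ρ →
      DifferentiableOn ℂ g (Metric.ball 0 R') → (∃ P : MvPolynomial (Fin 2) ℚ, P ≠ 0 ∧ ∀ t ∈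
      Metric.ball (0 : ℂ) R', MvPolynomial.aeval ![t, g t] P = 0) → ∀ r : KZ.IntegralRep 1, r.domain
      = Set.univ → (∀ z : Fin 1 → ℝ, r.integrand z = (g ((ρ : ℂ) * (1 + (z 0 : ℂ) * Complex.I) / (1
      - (z 0 : ℂ) * Complex.I)) * ((ρ : ℂ) * (2 * Complex.I) / (1 - (z 0 : ℂ) * Complex.I) ^ 2)).re)
      → KZ.of r ∈ R) → ∀ y ∈ AddSubgroup.closure ({c : KZ.FormalRep | ∃ s : KZ.IntegralRep 0, c =
      KZ.of s} ∪ {c : KZ.FormalRep | ∃ s : KZ.IntegralRep 1, c = KZ.of s} ∪ {c : KZ.FormalRep | ∃ s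
      : KZ.IntegralRep 2, Bornology.IsBounded s.domain ∧ (∀ v ∈ s.domain, s.integrand v = 1) ∧ c =
      KZ.of s}), KZ.eval y = 0 → y ∈ R) := by
  constructor
  · intro hK
    refine ⟨sectorReduction_of_orientationKernel hK, ?_⟩
    intro R hRel hI hII hIII y _ hy
    exact hK R hRel hI hII hIII y hy
  · rintro ⟨hred, hker⟩
    intro R hRel hI hII hIII x hx
    obtain ⟨y, hyS, hxy⟩ := hred x hx
    have hy0 : KZ.eval y = 0 := by
      have h : KZ.eval (x - y) = 0 := KZ.relations_le_ker_eval_holds hxy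
      rwa [map_sub, hx, zero_sub, neg_eq_zero] at h
    have hyR : y ∈ R := hker R hRel hI hII hIII y hyS hy0
    simpa using R.add_mem (hRel hxy) hyR

/-- **The bounded planar kernel settles the sector.** If any two BOUNDED planar representations with
integrand `1` and equal area are congruent modulo the moves, then every element of the 1-period
sector `S` with value `0` lies in `KZ.relations`: merge `y ≡ [A] − [B]` (`stub_sectorMerge`, landed),
read `vol A = vol B` off soundness, conclude. [folklore; Kontsevich–Zagier 2001, §1.2] -/
theorem sector_mem_relations_of_boundedPlanarKernel
    (h : ∀ A B : KZ.IntegralRep 2, Bornology.IsBounded A.domain → Bornology.IsBounded B.domain →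
      (∀ v ∈ A.domain, A.integrand v = 1) → (∀ v ∈ B.domain, B.integrand v = 1) →
      A.value = B.value → KZ.of A - KZ.of B ∈ KZ.relations) :
    ∀ y ∈ AddSubgroup.closure ({c : KZ.FormalRep | ∃ s : KZ.IntegralRep 0, c = KZ.of s} ∪ {c :
        KZ.FormalRep | ∃ s : KZ.IntegralRep 1, c = KZ.of s} ∪ {c : KZ.FormalRep | ∃ s :
        KZ.IntegralRep 2, Bornology.IsBounded s.domain ∧ (∀ v ∈ s.domain, s.integrand v = 1) ∧ c =
        KZ.of s}),
      KZ.eval y = 0 → y ∈ KZ.relations := by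
  intro y hyS hy0
  obtain ⟨A, B, hAb, hBb, hA, hB, hyAB⟩ := stub_sectorMerge y hyS
  have hAB : A.value = B.value := by
    have h' : KZ.eval (y - (KZ.of A - KZ.of B)) = 0 := KZ.relations_le_ker_eval_holds hyAB
    rwa [map_sub, map_sub, KZ.eval_of, KZ.eval_of, hy0, zero_sub, neg_eq_zero, sub_eq_zero] at h'
  simpa using KZ.relations.add_mem hyAB (h A B hAb hBb hA hB hAB)

/-- **The bounded planar kernel gives the restricted crux** (`SectorKernel`) for every admissible `R`
(indeed for every `R ≥ KZ.relations`, the relator hypotheses being idle here):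
`sector_mem_relations_of_boundedPlanarKernel` and `KZ.relations ≤ R`. [folklore] -/
theorem sectorKernel_of_boundedPlanarKernel
    (h : ∀ A B : KZ.IntegralRep 2, Bornology.IsBounded A.domain → Bornology.IsBounded B.domain →
      (∀ v ∈ A.domain, A.integrand v = 1) → (∀ v ∈ B.domain, B.integrand v = 1) →
      A.value = B.value → KZ.of A - KZ.of B ∈ KZ.relations) :
    ∀ R : AddSubgroup KZ.FormalRep, KZ.relations ≤ R → (∀ (p : MvPolynomial (Fin 2) ℚ), IsCompact {v
    : Fin 2 → ℝ | MvPolynomial.aeval v p = 0} → (∀ w : Fin 2 → ℂ, MvPolynomial.aeval w p = 0 → ∃ i,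
    MvPolynomial.aeval w (MvPolynomial.pderiv i p) ≠ 0) → Irreducible (MvPolynomial.map (algebraMap
    ℚ ℂ) p) → ¬ IsPreconnected {w : Fin 2 → ℂ | MvPolynomial.aeval w p = 0 ∧ ∃ i, (w i).im ≠ 0} → ∀
    (k : ℕ) (O : Fin k → Set (Fin 2 → ℝ)) (s : Fin k → KZ.IntegralRep 2), (∀ i, ∃ v : Fin 2 → ℝ,
    MvPolynomial.aeval v p = 0 ∧ O i = connectedComponentIn {u : Fin 2 → ℝ | MvPolynomial.aeval u p
    = 0} v) → Function.Injective O → (∀ v : Fin 2 → ℝ, MvPolynomial.aeval v p = 0 → ∃ i, v ∈ O i) →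
    (∀ i, (s i).domain = {v : Fin 2 → ℝ | v ∉ O i ∧ Bornology.IsBounded (connectedComponentIn (O i)ᶜ
    v)}) → (∀ i, ∀ v ∈ (s i).domain, (s i).integrand v = 1) → ∀ (η : Fin k → ℤ) (β : ℝ) (e :
    KZ.IntegralRep 2), (∀ i, η i = 1 ∨ η i = -1) → IsAlgebraic ℚ β → 0 ≤ β → e.domain = {v : Fin 2 →
    ℝ | v 0 ^ 2 + v 1 ^ 2 < β} → (∀ v ∈ e.domain, e.integrand v = 1) → ∑ i, (η i : ℝ) * (s i).value
    = e.value → (∑ i, η i • KZ.of (s i)) - KZ.of e ∈ R) → (∀ (p : MvPolynomial (Fin 2) ℚ), IsCompact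
    {v : Fin 2 → ℝ | MvPolynomial.aeval v p = 0} → (∀ v : Fin 2 → ℝ, MvPolynomial.aeval v p = 0 → ∃
    i, MvPolynomial.aeval v (MvPolynomial.pderiv i p) ≠ 0) → ∀ (k : ℕ) (O : Fin k → Set (Fin 2 → ℝ))
    (s : Fin k → KZ.IntegralRep 2), (∀ i, ∃ v : Fin 2 → ℝ, MvPolynomial.aeval v p = 0 ∧ O i =
    connectedComponentIn {u : Fin 2 → ℝ | MvPolynomial.aeval u p = 0} v) → Function.Injective O → (∀
    v : Fin 2 → ℝ, MvPolynomial.aeval v p = 0 → ∃ i, v ∈ O i) → (∀ i, (s i).domain = {v : Fin 2 → ℝ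
    | v ∉ O i ∧ Bornology.IsBounded (connectedComponentIn (O i)ᶜ v)}) → (∀ i, ∀ v ∈ (s i).domain, (s
    i).integrand v = 1) → ∀ (n : Fin k → ℤ) (β : ℝ) (e : KZ.IntegralRep 2), IsAlgebraic ℚ β → 0 ≤ β
    → e.domain = {v : Fin 2 → ℝ | v 0 ^ 2 + v 1 ^ 2 < β} → (∀ v ∈ e.domain, e.integrand v = 1) → ∑
    i, (n i : ℝ) * (s i).value = e.value → (∑ i, n i • KZ.of (s i)) - KZ.of e ∈ R) → (∀ (ρ R' : ℝ)
    (g : ℂ → ℂ), 0 < ρ → ρ < R' → IsAlgebraic ℚ ρ → DifferentiableOn ℂ g (Metric.ball 0 R') → (∃ P :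
    MvPolynomial (Fin 2) ℚ, P ≠ 0 ∧ ∀ t ∈ Metric.ball (0 : ℂ) R', MvPolynomial.aeval ![t, g t] P =
    0) → ∀ r : KZ.IntegralRep 1, r.domain = Set.univ → (∀ z : Fin 1 → ℝ, r.integrand z = (g ((ρ : ℂ)
    * (1 + (z 0 : ℂ) * Complex.I) / (1 - (z 0 : ℂ) * Complex.I)) * ((ρ : ℂ) * (2 * Complex.I) / (1 -
    (z 0 : ℂ) * Complex.I) ^ 2)).re) → KZ.of r ∈ R) → ∀ y ∈ AddSubgroup.closure ({c : KZ.FormalRep |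
    ∃ s : KZ.IntegralRep 0, c = KZ.of s} ∪ {c : KZ.FormalRep | ∃ s : KZ.IntegralRep 1, c = KZ.of s}
    ∪ {c : KZ.FormalRep | ∃ s : KZ.IntegralRep 2, Bornology.IsBounded s.domain ∧ (∀ v ∈ s.domain,
    s.integrand v = 1) ∧ c = KZ.of s}), KZ.eval y = 0 → y ∈ R := by
  intro R hRel _ _ _ y hyS hy0
  exact hRel (sector_mem_relations_of_boundedPlanarKernel h y hyS hy0)

/-- **The planar kernel 4990 gives the bounded planar kernel**: the registered stub `stub_planarAreas`
(= item stmt-KontsevichZagierPeriods-4990 `PlanarAreas`, verbatim) specialised to bounded domains;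
`KZ.Equivalent A B` is `[A] − [B] ∈ KZ.relations` by definition. [folklore] -/
theorem boundedPlanarKernel_of_planarAreas
    (h : ∀ (r r' : KZ.IntegralRep 2), (∀ p ∈ r.domain, r.integrand p = 1) →
      (∀ p ∈ r'.domain, r'.integrand p = 1) → r.value = r'.value → KZ.Equivalent r r') :
    ∀ A B : KZ.IntegralRep 2, Bornology.IsBounded A.domain → Bornology.IsBounded B.domain →
      (∀ v ∈ A.domain, A.integrand v = 1) → (∀ v ∈ B.domain, B.integrand v = 1) →
      A.value = B.value → KZ.of A - KZ.of B ∈ KZ.relations :=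
  fun A B _ _ hA hB hAB => h A B hA hB hAB

end Summit.KontsevichZagierPeriods.ComplexOrientations.OrientationKernel
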